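import Summits.QuantumFields.BalabanUV.T4Continuum.Spine.NE2.ComposedRemainderTower

/-!
# T⁴ programme, spine node NE2 (U1a) — R14 W3 proper, file 5: THE (3.26)-SHAPE END WITH THE FULL LINEARISED COMPOSED AVERAGING ([B9] (3.15) with [B7] (124) AT EVERY STEP), THE
# REMAINDER `E″` CONSTRUCTED AND ITS SIZE FIELD SUPPLIED (cell `pub-balaban-gaps`, seat ne2 gen 5)

Gen 4's `ComposedAveragingRemainder.composed_averaging_remainder_rate` is ROOT B ∘ tier B with print's composed averaging term `Q*(U)aQ(U)` in the B3 slot, the one-step remainders of (124)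
entering through a FREE operator family `Erem` with a DISPLAYED three-field datum `hRem : AveragingLaws (Δ_a⊗1) Erem (J⊗1) r (k ↦ C_r ρ^k)`.  THIS FILE instantiates `Erem k := ComposedRemainderTower.Erem
(W k) (C k) k` — the composed remainder CONSTRUCTED from the one-step data of problem `k` (fine transporters `W k (i+1)` and (124)'s coefficient operators `C k` at every step `i < k`) — and
SUPPLIES the size field from `ComposedRemainderTower.opNorm_Erem_le` with the explicit k-uniform `r = (1 + card o·(e^{qα} − 1))·c_R·Γ·e^{E}` (`q = (d+1)L`, `c_R = card o·2d(2d+2)L^d`):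
**`composed_full_averaging_rate`**.  Displayed in place of `hRem`: the one-step letters `σ k i` (main table), `γ k i` (coefficient operators; print `O(L²α₀(L^iη)²)`), their sums `Γ`, `E`, contractive
`R̄`, and the TWO SANDWICHED TWO-LEVEL FIELDS of the constructed `Erem` (`hRem₂`, `hRem₃` — NE3-type cross-problem consistency of the remainder, successor's W3a); everything else exactly as in gen 4.
Also: `norm_Smain_sub_one_le` (the main-table letter from per-bond sizes, for discharging `σ`).
HONEST FRAMING (T4-DAG p. 1).  MODEL LEVEL; `R`, `W`, `C`, `P₄` and every letter on them are DISPLAYED hypotheses asserted by nobody; node NE3's `LocalRate` consumed BY NAME (OPEN); NOT NE2, NOT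
[B9] (3.16)/(3.26) or [B7] (124) as printed; **NE2 (U1a) NOT PROVED**; spine PROVED 0/9 unchanged; NOT continuum YM / infinite volume / mass gap / Clay.  HONEST DEPENDENCY: continuum YM on
T⁴ ⇐ BetaPertH ∧ nine spine estimates (0/9 proved); BetaPertH ⇐ (D1) ∧ (D4) ∧ CAP+tail; G-an2-4 gates asym, D1 and NE2/3/4.  No `sorry`.
-/

noncomputable section

open scoped BigOperators ComplexConjugate Matrix Matrix.Norms.L2Operator Kronecker
open Finset (range)

namespace Summit.QuantumFields.BalabanUV.T4Continuum.NE2.ComposedFullAveragingRate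

open Literature.MathematicalPhysics.QuantumFieldTheory.Balaban1983to89.B5Prop11Plancherel (Tor fine Cst)
open Literature.MathematicalPhysics.QuantumFieldTheory.Balaban1983to89.B5G183RateUnitTower (lev lev_neZero)
open Literature.MathematicalPhysics.QuantumFieldTheory.Balaban1983to89.T4EtaRateMin (LocalRate)
open Summit.QuantumFields.BalabanUV.T4Continuum
open Summit.QuantumFields.BalabanUV.T4Continuum.BalabanAveragedTowerUnit (idx Qlev)
open Summit.QuantumFields.BalabanUV.T4Continuum.KingPairingPlantedLaw (JpcT calDalev CJ)
open Summit.QuantumFields.BalabanUV.T4Continuum.GramPerturbationLaw (AveragingLaws C2gram)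
open Summit.QuantumFields.BalabanUV.T4Continuum.CovariantAveragingTower (TowerLimitRate)
open Summit.QuantumFields.BalabanUV.T4Continuum.BackgroundResolventTower (PerturbationLaws Cpert)
open Summit.QuantumFields.BalabanUV.T4Continuum.RegularBackgroundTower (RegularTransporters regClass)
open Summit.QuantumFields.BalabanUV.T4Continuum.NE2FromNE3 (bgReadings)
open Summit.QuantumFields.BalabanUV.T4Continuum.CovariantAveragingSummand (kappaQ)
open Summit.QuantumFields.BalabanUV.T4Continuum.NE2BalabanLayer (tierBPert kappaB C2B)
open Summit.QuantumFields.BalabanUV.T4Continuum.CovariantBlockAveraging (transport norm_transport_sub_one_le)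
open Summit.QuantumFields.BalabanUV.T4Continuum.NE2.CovariantTableBalaban (TBal contourFrom length_contourFrom)
open Summit.QuantumFields.BalabanUV.T4Continuum.NE2.ComposedAveragingMean (thetaZero)
open Summit.QuantumFields.BalabanUV.T4Continuum.NE2.ComposedAveragingRate (norm_TBal_sub_one_le_exp)
open Summit.QuantumFields.BalabanUV.T4Continuum.NE2.ComposedAveragingRemainder (avgPertFull composed_averaging_remainder_rate)
open Summit.QuantumFields.BalabanUV.T4Continuum.NE2.OneStepRemainder (Smain)
open Summit.QuantumFields.BalabanUV.T4Continuum.NE2.ComposedRemainderTower (RemCoeff Erem cR cR_nonneg opNorm_Erem_le)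

variable {d : ℕ}

section Step

variable (n L : ℕ) [NeZero n] [NeZero L] (M : Fin d → ℕ) [hM : ∀ μ, NeZero (M μ)] {o : Type*} [Fintype o] [DecidableEq o]

omit hM in
/-- **THE MAIN-TABLE LETTER FROM PER-BOND SIZES**: `‖Smain(V)(x,r,μ,s) − 1‖ ≤ (1 + a)^{(d+1)L} − 1` for `s < L` when `‖V − 1‖ ≤ a` per bond (the one-step contour has `< (d+1)L` bonds). [folklore] -/
theorem norm_Smain_sub_one_le {V : Fin d → (Tor (fine (L * n) M) × Fin d → Matrix o o ℂ)} {a : ℝ} (ha : 0 ≤ a) (hV : ∀ ν b, ‖V ν b - 1‖ ≤ a)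
    (x : Tor (fine n M)) (r : Fin d → Fin L) (μ : Fin d) (s : Fin L) : ‖Smain n L M V x r μ s - 1‖ ≤ (1 + a) ^ ((d + 1) * L) - 1 := by
  rw [Smain]
  refine norm_transport_sub_one_le (fine (L * n) M) ha hV μ ?_
  rw [length_contourFrom]
  calc (∑ ν, (r ν : ℕ)) + (s : ℕ) ≤ (∑ _ν : Fin d, L) + L := add_le_add (Finset.sum_le_sum fun ν _ => (r ν).isLt.le) s.isLt.le
    _ = (d + 1) * L := by rw [Finset.sum_const, Finset.card_univ, Fintype.card_fin, smul_eq_mul]; ring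

end Step

section End

variable (L : ℕ) [NeZero L] (M : Fin d → ℕ) [hM : ∀ μ, NeZero (M μ)] {o : Type*} [Fintype o] [DecidableEq o] (a : ℝ) (ha : 0 < a)

/-- **THE (3.26)-SHAPE END WITH THE FULL LINEARISED COMPOSED AVERAGING, `E″` CONSTRUCTED**: `composed_averaging_remainder_rate` with `Erem k := ComposedRemainderTower.Erem (W k) (C k) k` and its size
field supplied by `opNorm_Erem_le` (`r = (1 + card o·(e^{qα} − 1))·c_R·Γ·e^{E}`); displayed instead: the one-step letters `σ`, `γ` with their sums `Γ`, `E`, contractive `R̄`, and the two sandwiched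
two-level fields `hRem₂`/`hRem₃` of the constructed remainder. [cite: Balaban1985BackgroundPropagators, (3.15)–(3.16) p.393, (3.26) p.395; Balaban1985Averaging, (124) p.36, (139)–(143) p.39; King1986, Lemma 4.5 (4.38) p.674 (method)] [folklore] -/
theorem composed_full_averaging_rate [Nonempty o] (hL : 2 ≤ L) (hd : 1 ≤ d) {R : (k : ℕ) → Fin d → (idx L M k → Matrix o o ℂ)} {αR βR : ℝ}
    (hreg : RegularTransporters L M R αR βR) {C : ℝ} (hC : 0 ≤ C) (hNE3 : LocalRate (bgReadings L M (regClass L M R)) C ((L : ℝ)⁻¹))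
    {W : ℕ → (i : ℕ) → Fin d → (idx L M i → Matrix o o ℂ)} {α σ θc ρ : ℝ}
    (hα : 0 ≤ α) (hσ : 0 ≤ σ) (hθ0 : 0 ≤ θc) (hθ1 : θc ≤ 1) (hθρ : θc ≤ ρ) (hρ : 3 / (2 * (L : ℝ)) ≤ ρ) (hρ1 : ρ < 1)
    (hWn : ∀ k i ν b, ‖W k i ν b‖ ≤ 1) (hWa : ∀ k i ν b, ‖W k i ν b - 1‖ ≤ α / (lev L i : ℕ))
    (hWc : ∀ k i ν b, i ≤ k → ‖W (k + 1) i ν b - W k i ν b‖ ≤ σ * θc ^ k / (lev L i : ℕ))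
    {Cf : ℕ → RemCoeff d L M o} {σ₁ γ : ℕ → ℕ → ℝ} {Γ E Cr : ℝ} (hσ₁0 : ∀ k i, 0 ≤ σ₁ k i) (hγ0 : ∀ k i, 0 ≤ γ k i)
    (hS : ∀ k i x r μ (s : Fin L), ‖(haveI := lev_neZero L i; Smain (lev L i) L M (W k (i + 1)) x r μ s) - 1‖ ≤ σ₁ k i)
    (hG₁ : ∀ k i x μ r, ‖(Cf k).G₁ i x μ r‖ ≤ γ k i) (hG₂ : ∀ k i x μ r, ‖(Cf k).G₂ i x μ r‖ ≤ γ k i) (hG₃ : ∀ k i x μ, ‖(Cf k).G₃ i x μ‖ ≤ γ k i) (hRc : ∀ k i x μ, ‖(Cf k).Rc i x μ‖ ≤ 1)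
    (hΓ : ∀ k k', ∑ i ∈ range k', γ k i ≤ Γ) (hE : ∀ k k', ∑ i ∈ range k', (Fintype.card o * σ₁ k i + cR d L o * γ k i) ≤ E)
    (hRem₂ : ∀ k, ‖(Erem L M (W (k + 1)) (Cf (k + 1)) (k + 1) * (JpcT L M k ⊗ₖ (1 : Matrix o o ℂ)) - Erem L M (W k) (Cf k) k) * (calDalev L M a ha k ⊗ₖ (1 : Matrix o o ℂ))⁻¹‖ ≤ Cr * ρ ^ k)
    (hRem₃ : ∀ k, ‖(calDalev L M a ha k ⊗ₖ (1 : Matrix o o ℂ))⁻¹ * (Erem L M (W (k + 1)) (Cf (k + 1)) (k + 1) * (JpcT L M k ⊗ₖ (1 : Matrix o o ℂ)) - Erem L M (W k) (Cf k) k)ᴴ‖ ≤ Cr * ρ ^ k)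
    {P₄ : (k : ℕ) → Matrix (idx L M k × o) (idx L M k × o) ℂ} {κ₄ C₄ : ℝ}
    (hP₄ : PerturbationLaws (fun k => calDalev L M a ha k ⊗ₖ (1 : Matrix o o ℂ)) P₄ (fun k => JpcT L M k ⊗ₖ (1 : Matrix o o ℂ)) κ₄ (fun k => C₄ * ρ ^ k))
    (hsmall : kappaB o d a αR βR C (kappaQ d a (a : ℂ) (Fintype.card o * (Real.exp ((((d + 1) * L : ℕ) : ℝ) * α) - 1)
      + (1 + Fintype.card o * (Real.exp ((((d + 1) * L : ℕ) : ℝ) * α) - 1)) * cR d L o * Γ * Real.exp E)) κ₄ < 1) :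
    TowerLimitRate (fun k => Qlev L M k ⊗ₖ (1 : Matrix o o ℂ)) ((L : ℝ) ^ d)
      (fun k => (calDalev L M a ha k ⊗ₖ (1 : Matrix o o ℂ)
        + tierBPert L M R (avgPertFull L M a (fun k => TBal L M (W k) k) (fun k => Erem L M (W k) (Cf k) k)) P₄ k)⁻¹)
      (Cpert (kappaB o d a αR βR C (kappaQ d a (a : ℂ) (Fintype.card o * (Real.exp ((((d + 1) * L : ℕ) : ℝ) * α) - 1)
          + (1 + Fintype.card o * (Real.exp ((((d + 1) * L : ℕ) : ℝ) * α) - 1)) * cR d L o * Γ * Real.exp E)) κ₄) (2 * d * Cst d a) (CJ d a)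
        (C2B o d L a αR βR C
          (a * C2gram (Cst d a) 1 (Fintype.card o * (Real.exp ((((d + 1) * L : ℕ) : ℝ) * α) - 1)
              + (1 + Fintype.card o * (Real.exp ((((d + 1) * L : ℕ) : ℝ) * α) - 1)) * cR d L o * Γ * Real.exp E) (2 * d * Cst d a) (CJ d a) (Cst d a)
            (Cst d a * Fintype.card o * (thetaZero d L α σ + (Real.exp ((((d + 1) * L : ℕ) : ℝ) * α) - 1)) + Cr)) C₄) 0 1) ρ := by
  set τ : ℝ := Real.exp ((((d + 1) * L : ℕ) : ℝ) * α) - 1 with hτdef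
  have hτ0 : 0 ≤ τ := by
    rw [hτdef]; linarith [Real.add_one_le_exp ((((d + 1) * L : ℕ) : ℝ) * α), (by positivity : (0 : ℝ) ≤ (((d + 1) * L : ℕ) : ℝ) * α)]
  have hcR := cR_nonneg (d := d) L (o := o)
  have hΓ0 : 0 ≤ Γ := (Finset.sum_nonneg fun i _ => hγ0 0 i).trans (hΓ 0 1)
  have hr : 0 ≤ (1 + Fintype.card o * τ) * cR d L o * Γ * Real.exp E := by positivity
  -- the size field of the constructed remainder, problem by problem
  have hsize : ∀ k, ‖Erem L M (W k) (Cf k) k‖ ≤ (1 + Fintype.card o * τ) * cR d L o * Γ * Real.exp E := fun k =>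
    opNorm_Erem_le L M (W := W k) (C := Cf k) (σ := σ₁ k) (γ := γ k) hτ0 (hσ₁0 k) (hγ0 k) (hWn k)
      (fun k' y j μ t => norm_TBal_sub_one_le_exp L M hL hα (W := fun _ => W k) (fun _ i ν b => hWa k i ν b) k' y j μ t)
      (hS k) (hG₁ k) (hG₂ k) (hG₃ k) (hRc k) (hΓ k) (hE k) k
  have hRem : AveragingLaws (fun k => calDalev L M a ha k ⊗ₖ (1 : Matrix o o ℂ)) (fun k => Erem L M (W k) (Cf k) k)
      (fun k => JpcT L M k ⊗ₖ (1 : Matrix o o ℂ)) ((1 + Fintype.card o * τ) * cR d L o * Γ * Real.exp E) (fun k => Cr * ρ ^ k) :=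
    ⟨hsize, hRem₂, hRem₃⟩
  exact composed_averaging_remainder_rate L M a ha hL hd hreg hC hNE3 hα hσ hθ0 hθ1 hθρ hρ hρ1 hWn hWa hWc hr hRem hP₄ hsmall

end End

end Summit.QuantumFields.BalabanUV.T4Continuum.NE2.ComposedFullAveragingRate

end
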